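import Summits.CriticalPhenomena.PercolationContinuityZ3.Theorems.Transplant.SkelPhiRootClearY
import HarnessLib

/-!
# N2 (frames-only node `SamePDropOfSkeletonFrm₁`, OPEN), (R) column, (R-46)(e)(f) (design owner p3-g17 2026-08-23T12:33:02Z): **THE y′-CORRIDOR'S SEED
# CLEARANCE AS SQUARE AVOIDANCE, FROM LATTICE-FREE ROW FLOORS** — `Skelφ.north_or_off_column_of_rows`, `Skelφ.clear_of_kgCorrSchedY_rows4`

Successor of `clear_of_kgCorrSchedY_rows` (SkelPhiRootClearY, p358645; valid template with the stronger quadrant test): its across rows `hBrun/hBp₁/hBp₂`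
carry the UNIFORM along extent `|h|·kgZY₀ ∋ |h|·(N+2)|v|` and are undischargeable unless `h_L·v_L = 0` (p5-g16 12:24:07Z; p3-g17 12:33:02Z: no pair row
bounds `|h·v|` against the modulus).  The chain lemma only needs the regions to MISS THE SEED SQUARE `|x| ≤ kb ∧ |y| ≤ kb`, and north clearance is
ROWS-ONLY and lattice-free: if the corridor's frame origin `c` lies on or above the seed's row line (`h·X ≤ n·Y`, `(X, Y) := φ c − φ t`; (R-46)'s
`Y2R := ⌈h·X2R/n⌉`) then a point with run-frame row `r ≥ kb + 1` inside the seed column `|x| ≤ kb` has `n·y ≥ r·U + h·x − (nY − hX) ≥ (kb+1)(n+|h|) − |h|·kb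
> kb·n`, i.e. `y > kb` (`north_or_off_column_of_rows`); points off the column have `|x| > kb`.  Hence `clear_of_kgCorrSchedY_rows4`: LOW run regions `k ≤ k₀`
clear EAST (`hxrow`, as before), all other regions clear by the ROW FLOORS of p5-g16's region boxes alone — `hBrun4 : kb + 1 ≤ k·sLo − q − (k+1)R′ − L`,
`hBp4₁`, `hBp4₂` — no `h`, no `v`, no `Z`; conclusion the 4-way disjunction `kb < x ∨ kb < y ∨ x < −kb ∨ y < −kb` in the root frame (the V twins of the
(R) generic layer take this binder, (R-46)(e)).  Cell-free.
builds on p205010 (kernel theorem, internal audit signed; external expert review pending) — nothing in this file uses p205010; nothing here is a claim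
about the open node `SamePDropOfSkeletonFrm₁`.
Lane `prim-bschramm`, seat `prim-bschramm-p5` (gen 16; typed for the (R) column owner p3-g17 on (R-46)(f) GO); helper file (`--supports stmt-CriticalPhenomena-4575 --as helper`).
[cite: KozmaNitzan2024, §4 Lemma 11 (p. 22), Lemma 12 (pp. 23–25)] [cite: MartineauTassion2017, §3.2]
-/

noncomputable section

namespace Summit.CriticalPhenomena.PercolationContinuityZ3.Theorems

namespace Transplant

namespace Skelφ

open Literature.Probability.Percolation Literature.Probability.LatticeModels SimpleGraph
open ChainPlanar ChainPara

variable {V : Type} {φ : V → Site 2}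

/-- **NORTH OR OFF THE COLUMN, FROM ROWS** ((R-46)(f)): if the run frame's origin `c` lies on or above the seed's row line through `t` (`h·X ≤ n·Y`) and a
vertex `w` has run-frame row `≥ kb + 1`, then in the root frame `kb < x ∨ kb < y ∨ x < −kb` (`n·y ≥ r·U + h·x ≥ (kb+1)(n+|h|) − |h|·kb > kb·n` on the column).
[cite: KozmaNitzan2024, §4 Lemma 11 (p. 22)] -/
theorem north_or_off_column_of_rows (t c : V) {n : ℕ} (hn : 1 ≤ n) (h : ℤ) {X Y : ℤ} (hX : φ c 0 - φ t 0 = X) (hY : φ c 1 - φ t 1 = Y)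
    (hXY : h * X ≤ (n : ℤ) * Y) {kb : ℤ} {w : V} (hr : kb + 1 ≤ runX φ c n h 1 w 1) :
    kb < rootFrame φ t 1 w 0 ∨ kb < rootFrame φ t 1 w 1 ∨ rootFrame φ t 1 w 0 < -kb := by
  have hU : 0 < (shearUnit n h : ℤ) := shearUnit_pos hn h
  rw [runX_one, shearCoord_apply, one_mul] at hr
  rw [rootFrame_one_apply_zero, rootFrame_one_apply_one]
  -- the floor bound gives the real bound on the shear sum
  have hs : (kb + 1) * (shearUnit n h : ℤ) ≤ (n : ℤ) * (φ w 1 - φ c 1) - h * (φ w 0 - φ c 0) :=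
    le_trans (mul_le_mul_of_nonneg_right hr hU.le) (Int.ediv_mul_le _ hU.ne')
  have hUeq : (shearUnit n h : ℤ) = n + |h| := by simp [shearUnit]
  by_cases hx : |φ w 0 - φ t 0| ≤ kb
  · -- on the seed column: north
    right; left
    have hc1 : φ w 1 - φ c 1 = (φ w 1 - φ t 1) - Y := by rw [← hY]; ring
    have hc0 : φ w 0 - φ c 0 = (φ w 0 - φ t 0) - X := by rw [← hX]; ring
    rw [hc1, hc0, hUeq] at hs
    -- `h·x ≥ −|h|·kb`
    have hhx : -(|h| * kb) ≤ h * (φ w 0 - φ t 0) := by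
      have h1 : -|h * (φ w 0 - φ t 0)| ≤ h * (φ w 0 - φ t 0) := neg_abs_le _
      rw [abs_mul] at h1
      have h2 : |h| * |φ w 0 - φ t 0| ≤ |h| * kb := mul_le_mul_of_nonneg_left hx (abs_nonneg _)
      linarith
    have hh0 : (0 : ℤ) ≤ |h| := abs_nonneg _
    have hn0 : (0 : ℤ) < n := by exact_mod_cast hn
    -- `n·y ≥ (kb+1)(n+|h|) + h·x + (nY − hX) ≥ (kb+1)n + |h| > n·kb`
    have hs' : kb * (n : ℤ) + kb * |h| + n + |h| ≤ (n : ℤ) * (φ w 1 - φ t 1) - n * Y - h * (φ w 0 - φ t 0) + h * X := by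
      have e : (kb + 1) * ((n : ℤ) + |h|) = kb * (n : ℤ) + kb * |h| + n + |h| := by ring
      have e' : (n : ℤ) * (φ w 1 - φ t 1 - Y) - h * (φ w 0 - φ t 0 - X) = (n : ℤ) * (φ w 1 - φ t 1) - n * Y - h * (φ w 0 - φ t 0) + h * X := by ring
      rw [e, e'] at hs; exact hs
    have hny : (n : ℤ) * kb < (n : ℤ) * (φ w 1 - φ t 1) := by nlinarith [hs', hXY, hhx, hh0]
    exact lt_of_mul_lt_mul_left hny hn0.le
  · -- off the column: east or west
    rw [not_le] at hx
    rcases lt_abs.1 hx with h1 | h1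
    · exact Or.inl h1
    · exact Or.inr (Or.inr (by linarith))

section KG

variable {n ℓ : ℕ} {h v : ℤ} {R' ρ q W N m₁ Wm₂ Wp₂ m₂ : ℕ} (hn : 1 ≤ n) (hv : |v| ≤ n) (hlay : (n + h.natAbs : ℕ) ≤ (n : ℤ) * ℓ + 1)
  (hP₁ : ParkOK (kgPark₁Y n ℓ h v R' ρ q W N m₁)) (hP₂ : ParkOK (kgPark₂Y n ℓ h v R' ρ q W N m₁ Wm₂ Wp₂ m₂))
  (hsplit : (Wm₂ : ℤ) + Wp₂ = (kgPark₁Y n ℓ h v R' ρ q W N m₁).aHi (m₁ + 1) - ParkPrm.aLo (kgPark₁Y n ℓ h v R' ρ q W N m₁) (m₁ + 1))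

include hn hv hlay hP₁ hP₂ hsplit in
/-- **THE y′-CORRIDOR MISSES THE SEED SQUARE, FROM LATTICE-FREE NUMERIC ROWS** ((R-46)(e)(f)): frame origin on or above the seed's row line
(`h·X ≤ n·Y`); LOW run regions `k ≤ k₀` clear EAST (`hxrow`, the x′-lower edge of `kgCorrSchedY_region_run_box` plus `X` exceeds `kb`); every other region
has its ROW FLOOR above `kb` (`hBrun4`, `hBp4₁`, `hBp4₂` — the rows-lower edges of `…_run_box/_park₁_box/_park₂_box`); conclusion: every vertex read in any
region satisfies `kb < x ∨ kb < y ∨ x < −kb ∨ y < −kb` in the root frame. [cite: KozmaNitzan2024, §4 Lemma 11 (p. 22)] -/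
theorem clear_of_kgCorrSchedY_rows4 (t c : V) {X Y : ℤ} (hX : φ c 0 - φ t 0 = X) (hY : φ c 1 - φ t 1 = Y) (hXY : h * X ≤ (n : ℤ) * Y)
    {kb : ℤ} (k₀ : ℕ)
    -- x′ rows for the low run regions (east clearance)
    (hxrow : ∀ k ≤ k₀, kb < ((k : ℤ) * v - (((n + v).toNat + W : ℕ) : ℤ) - ((k : ℤ) + 1) * R' - n) + X)
    -- row floors for the high run regions and the two parking phases (north clearance on the column)
    (hBrun4 : ∀ k, k₀ < k → k ≤ N →
      kb + 1 ≤ (k : ℤ) * (((n : ℤ) * ℓ - (shearUnit n h : ℕ) + 1) / (shearUnit n h : ℕ)) - q - ((k : ℤ) + 1) * R' - ((3 * (n * ℓ) / shearUnit n h + 1 : ℕ) : ℤ))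
    (hBp4₁ : ∀ j ≤ m₁, kb + 1 ≤ ((N : ℤ) + 1) * (((n : ℤ) * ℓ - (shearUnit n h : ℕ) + 1) / (shearUnit n h : ℕ)) - ((q : ℤ) + (N + 1) * R') -
      (j : ℤ) * (R' + ρ) - R' - ((3 * (n * ℓ) / shearUnit n h + 1 : ℕ) : ℤ))
    (hBp4₂ : kb + 1 ≤ ((N : ℤ) + 1) * (((n : ℤ) * ℓ - (shearUnit n h : ℕ) + 1) / (shearUnit n h : ℕ)) - ((q : ℤ) + (N + 1) * R') -
      ((m₁ : ℤ) + 1) * (R' + ρ) - ((n : ℤ) * ℓ / (shearUnit n h : ℕ) + 1) - R' - ((3 * (n * ℓ) / shearUnit n h + 1 : ℕ) : ℤ)) :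
    ∀ k ≤ (kgCorrSchedY hn hv hlay hP₁ hP₂ hsplit).N, ∀ w : V, runX φ c n h 1 w ∈ (kgCorrSchedY hn hv hlay hP₁ hP₂ hsplit).region k →
      kb < rootFrame φ t 1 w 0 ∨ kb < rootFrame φ t 1 w 1 ∨ rootFrame φ t 1 w 0 < -kb ∨ rootFrame φ t 1 w 1 < -kb := by
  intro k hk w hw
  have hSN := (kgCorrSchedY_params hn hv hlay hP₁ hP₂ hsplit).1
  -- the three-way conclusion of the column lemma embeds into the four-way one
  have emb : (kb < rootFrame φ t 1 w 0 ∨ kb < rootFrame φ t 1 w 1 ∨ rootFrame φ t 1 w 0 < -kb) →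
      kb < rootFrame φ t 1 w 0 ∨ kb < rootFrame φ t 1 w 1 ∨ rootFrame φ t 1 w 0 < -kb ∨ rootFrame φ t 1 w 1 < -kb := by
    rintro (h1 | h1 | h1)
    · exact Or.inl h1
    · exact Or.inr (Or.inl h1)
    · exact Or.inr (Or.inr (Or.inl h1))
  by_cases hkN : k ≤ N
  · -- run phase: east for the low regions, north/off-column above
    obtain ⟨hr1, -, hx1, -⟩ := kgCorrSchedY_region_run_box hn hv hlay hP₁ hP₂ hsplit hkN hw
    by_cases hk0 : k ≤ k₀
    · exact Or.inl (lt_rootFrame_zero_of_runX t c n h hX hx1 (hxrow k hk0))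
    · exact emb (north_or_off_column_of_rows t c hn h hX hY hXY (le_trans (hBrun4 k (by omega) hkN) hr1))
  · by_cases hk1 : k ≤ N + 1 + m₁
    · -- first parking phase
      obtain ⟨j, rfl⟩ : ∃ j, k = N + 1 + j := ⟨k - (N + 1), by omega⟩
      have hj : j ≤ m₁ := by omega
      obtain ⟨hr1, -, -, -⟩ := kgCorrSchedY_region_park₁_box hn hv hlay hP₁ hP₂ hsplit hj hw
      exact emb (north_or_off_column_of_rows t c hn h hX hY hXY (le_trans (hBp4₁ j hj) hr1))
    · -- second parking phase
      obtain ⟨j, rfl⟩ : ∃ j, k = N + 1 + m₁ + 1 + j := ⟨k - (N + 1 + m₁ + 1), by omega⟩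
      obtain ⟨hr1, -, -, -⟩ := kgCorrSchedY_region_park₂_box hn hv hlay hP₁ hP₂ hsplit j hw
      exact emb (north_or_off_column_of_rows t c hn h hX hY hXY (le_trans hBp4₂ hr1))

end KG

end Skelφ

end Transplant

end Summit.CriticalPhenomena.PercolationContinuityZ3.Theorems

end
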